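import Literature.AlgebraicGeometry.Motives.KugaSatakeCorrespondenceAlgebraic
import Literature.AlgebraicGeometry.Surfaces.K3Surface
import HarnessLib

/-!
# The Kuga–Satake correspondence of K3 surfaces, graded by the transcendental rank
# (Huybrechts Ch. 4 §2.5–2.6, Floccari §3.3–3.4 and Thm. 5.11) — two predicates

Noether–Lefschetz inductions on the property `BettiHodgeData.IsKSCorrespondenceAlgebraic B hS L`
("the Kuga–Satake correspondence of the lattice-polarized K3 surface `(S, L)` is algebraic",
file `Motives/KugaSatakeCorrespondenceAlgebraic`) run on the rank `r = rk T(S)_ℚ` of the rational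
transcendental lattice: the rank-`r` lattice-polarized moduli space has dimension `r - 2`, its
proper Noether–Lefschetz members are the lattice-polarized surfaces `(S', L)` with
`rk L^⊥ = r > rk T(S')`, and a surface with an isotropic plane `U ⊕ U ↪ T(S)_ℚ` and `r ≤ 6` has
`T(S)_ℚ ↪ (U³ ⊕ ⟨-m⟩)_ℚ`, the hypothesis of Floccari, Thm. 5.11 ("Let `S` be a projective K3
surface such that there exist an isometry `T(S)_ℚ ↪ (U³ ⊕ ⟨-m⟩)_ℚ` … Then the Kuga–Satake
correspondence is algebraic for `S`", arXiv:2501.02315 p. 18). This file names, relative to a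
Betti–Hodge datum `B`, the two rank-graded PROPERTIES such an induction quantifies over — nothing is
asserted:

* `B.IsKSCAlgebraicAtRank r` — every complex projective K3 surface `S` with `rk T(S)_ℚ = r` and an
  isotropic plane in `T(S)_ℚ` has `B.IsKSCorrespondenceAlgebraic hS NS(S)_ℚ` (the case `L = NS(S)_ℚ`,
  Floccari Rem. 3.4);
* `B.IsKSCAnchoredAtRank r` — the same for every lattice-polarized `(S, L)`, `L ⊆ NS(S)_ℚ`, with
  `rk L^⊥ = r` and `rk T(S)_ℚ < r` (a proper Noether–Lefschetz member of the rank-`r` family;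
  Huybrechts Ch. 4 §2.5, "`T(X) ⊂ T(X)'` … `KS(T(X)')` is isogenous to `KS(T(X))^{2^d}`").

## Main statements

* `BettiHodgeData.forall_isKSCAlgebraicAtRank_iff` — `(∀ r, B.IsKSCAlgebraicAtRank r)` is the
  ungraded property "every projective K3 surface with `U ⊕ U ↪ T(S)_ℚ` has algebraic Kuga–Satake
  correspondence".
* `BettiHodgeData.IsKSCAnchoredAtRank.of_transcendentalRank_eq` — the anchored property says nothing
  about `L = NS(S)_ℚ` itself (there `rk L^⊥ = rk T(S)`), recorded as the degenerate case.
-/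

noncomputable section

namespace Literature.AlgebraicGeometry.Motives

namespace BettiHodgeData

variable (B : BettiHodgeData ℂ)

/-- `B.IsKSCAlgebraicAtRank r`: for every complex projective K3 surface `S` whose rational
transcendental lattice `T(S)_ℚ = NS(S)_ℚ^⊥` has rank `r` and contains a totally isotropic plane,
the Kuga–Satake correspondence of `(S, NS(S)_ℚ)` is algebraic
(`B.IsKSCorrespondenceAlgebraic hS NS(S)_ℚ`). A rank-graded property, asserted for no `r` here; for
`r ≤ 6` its instances are covered by Floccari, Thm. 5.11 (`T(S)_ℚ ↪ (U³ ⊕ ⟨-m⟩)_ℚ`).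
[cite: Floccari2026, Thm. 5.11 and Rem. 3.4] [cite: Huybrechts2016K3, Ch. 4 §2.6] -/
def IsKSCAlgebraicAtRank (r : ℕ) : Prop :=
  ∀ (S : SchemeOver ℂ) (hS : Surfaces.IsK3Surface S),
    B.transcendentalRank hS.isSmoothProjective = r →
    B.HasIsotropicPlane hS.isSmoothProjective →
    B.IsKSCorrespondenceAlgebraic hS.isSmoothProjective
      ((B.hodge hS.isSmoothProjective 2).hodgeClasses 1)

/-- `B.IsKSCAnchoredAtRank r`: for every lattice-polarized complex projective K3 surface `(S, L)` —
`L ⊆ NS(S)_ℚ` a space of Hodge classes with `rk L^⊥ = r` — which is a PROPER Noether–Lefschetz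
member of the rank-`r` family (`rk T(S)_ℚ < r`, i.e. `T(S)_ℚ ⊊ L^⊥`) and whose transcendental
lattice contains a totally isotropic plane, the Kuga–Satake correspondence of `(S, L)` is algebraic
(`B.IsKSCorrespondenceAlgebraic hS L`; the Kuga–Satake variety of `L^⊥ ⊋ T(S)` is Huybrechts'
`KS(T(X)')`, Ch. 4 §2.5). A rank-graded property, asserted for no `r` here.
[cite: Huybrechts2016K3, Ch. 4 §2.5–2.6] [cite: Floccari2026, §3.3–3.4] -/
def IsKSCAnchoredAtRank (r : ℕ) : Prop :=
  ∀ (S : SchemeOver ℂ) (hS : Surfaces.IsK3Surface S) (L : Submodule ℚ (B.W.obj S 2)),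
    L ≤ (B.hodge hS.isSmoothProjective 2).hodgeClasses 1 →
    Module.finrank ℚ ↥(LinearMap.BilinForm.orthogonal (B.W.cupPairing S 2 2 2 rfl) L) = r →
    B.transcendentalRank hS.isSmoothProjective < r →
    B.HasIsotropicPlane hS.isSmoothProjective →
    B.IsKSCorrespondenceAlgebraic hS.isSmoothProjective L

variable {B}

/-- The graded property over all ranks is the ungraded one: every projective K3 surface with an
isotropic plane in `T(S)_ℚ` has algebraic Kuga–Satake correspondence for `NS(S)_ℚ`. [folklore] -/
theorem forall_isKSCAlgebraicAtRank_iff :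
    (∀ r : ℕ, B.IsKSCAlgebraicAtRank r) ↔
      ∀ (S : SchemeOver ℂ) (hS : Surfaces.IsK3Surface S),
        B.HasIsotropicPlane hS.isSmoothProjective →
        B.IsKSCorrespondenceAlgebraic hS.isSmoothProjective
          ((B.hodge hS.isSmoothProjective 2).hodgeClasses 1) :=
  ⟨fun h S hS hI ↦ h _ S hS rfl hI, fun h _ S hS _ hI ↦ h S hS hI⟩

/-- Bounded form: the graded property below a bound `n` is the ungraded property for the surfaces of
transcendental rank `≤ n`. [folklore] -/
theorem forall_le_isKSCAlgebraicAtRank_iff (n : ℕ) :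
    (∀ r : ℕ, r ≤ n → B.IsKSCAlgebraicAtRank r) ↔
      ∀ (S : SchemeOver ℂ) (hS : Surfaces.IsK3Surface S),
        B.transcendentalRank hS.isSmoothProjective ≤ n →
        B.HasIsotropicPlane hS.isSmoothProjective →
        B.IsKSCorrespondenceAlgebraic hS.isSmoothProjective
          ((B.hodge hS.isSmoothProjective 2).hodgeClasses 1) :=
  ⟨fun h S hS hn hI ↦ h _ hn S hS rfl hI, fun h _ hr S hS hrS hI ↦ h S hS (hrS ▸ hr) hI⟩

/-- Degenerate case of the anchored property: it is silent about `L = NS(S)_ℚ` itself, because there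
`rk L^⊥ = rk T(S)_ℚ` and the strict inequality cannot hold. [folklore] -/
theorem IsKSCAnchoredAtRank.not_lt_of_eq {r : ℕ} {S : SchemeOver ℂ} (hS : Surfaces.IsK3Surface S)
    (hr : B.transcendentalRank hS.isSmoothProjective = r) :
    ¬ B.transcendentalRank hS.isSmoothProjective < r := by
  omega

/-- The anchored property at rank `r` together with the algebraic property at every rank `< r` is
exactly what a Noether–Lefschetz induction feeds into the rank-`r` step; conversely the algebraic
property at rank `r` is the anchored conclusion for `L = NS(S)_ℚ` (where `L^⊥ = T(S)_ℚ`). This lemma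
records the second, definitional, half: `IsKSCAlgebraicAtRank` is the `L = NS(S)_ℚ` reading. [folklore] -/
theorem isKSCAlgebraicAtRank_iff (r : ℕ) :
    B.IsKSCAlgebraicAtRank r ↔
      ∀ (S : SchemeOver ℂ) (hS : Surfaces.IsK3Surface S),
        Module.finrank ℚ ↥(B.transcendentalLattice hS.isSmoothProjective) = r →
        B.HasIsotropicPlane hS.isSmoothProjective →
        B.IsKSCorrespondenceAlgebraic hS.isSmoothProjective
          ((B.hodge hS.isSmoothProjective 2).hodgeClasses 1) :=
  Iff.rfl

end BettiHodgeData

end Literature.AlgebraicGeometry.Motives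

end
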